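import Literature.MathematicalPhysics.QuantumFieldTheory.Balaban1983to89.T4AveragingDeficitWall

/-!
# T⁴ programme, node NE3 (η-rate of the minimisers) — THE SECOND VARIATION OF THE WILSON ACTION ALONG BONDWISE
# EXPONENTIAL VARIATIONS: the derivative of the dressed curl, the exact MIXED HESSIAN FORM `hess V X Y`
# (`∂_s∂_t A((V e^{sX}) e^{tY})`), and the first∕second derivatives of `s ↦ A(V e^{sX})` AT EVERY `s`

First generation of the NE3 prover lineage P3 of the cell `pub-balaban` (unit `b2b-balaban-t4-ne3-p3`; co-owner #3 of
`BINDER-OWNERS.md` row NE3, ROUND-2 SKELETON-FIRST mandate).  This is the CONCRETE second-variation calculus that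
both energy-currency routes of row NE3 consume: route P3's leaf L2 (`HOME/t4/skeletons/NE3-t4-ne3-p3.md` v1,
71d0aef383766d71: straight-segment calculus `f(t) = A(vary U_A X t)`, `f′`, `f″ = hess`, and the mixed derivative
`h′(t) = ∂_t dA(vary U_A X t)[Y]` of the local step) and route P2's leaves L3∕L4 (`t4/skeletons/NE3-t4-ne3-p2.md` v1.3,
`hessForm W X Y` := the exact mixed second derivative) — by the two co-owners' shared-file agreement (CLAIMS.log
2026-08-20 l.5380: «YOURS TO OWN … the CONCRETE second-variation calculus — `hessForm W X Y` … + the segment∕path C²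
calculus … ONE file family `Support/NE3Hess*`»).  It extends the tree's FIRST-variation calculus of
`T4AveragingDeficitWall` §7 (`hasDerivAt_hol_vary`: `d/ds|₀ V_s(∂p′) = (d_V ψ)(p′)·V(∂p′)`; `hasDerivAt_fineAction_vary`)
by one order and from `s = 0` to every `s`.

WHAT IS PROVED ([folklore] matrix calculus over the tree's objects `vary`, `Ad`, `curlAt`, `hol`, `fhol`, `wt`,
`fineAction`, `nReTr`; no estimate, no Bałaban-specific hypothesis):
§1 `hasDerivAt_Ad_vary₁∕₂∕₃`: the derivative at `t = 0` of `t ↦ Ad_{P_t} Y` for the partial holonomies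
   `P_t = V₁e^{tX₁}`, `V₁e^{tX₁}V₂e^{tX₂}`, `V₁e^{tX₁}V₂e^{tX₂}(V₃e^{tX₃})⁻¹` of the plaquette word: `[ω, Ad_P Y]`
   with `ω` the partial dressed curl, written out;
§2 `dcurlAt V X Y` (explicit) and `hasDerivAt_curlAt_vary`: `d/dt|₀ (d_{V e^{tX}} Y)(p′) = dcurlAt V X Y p′`;
§3 `hessPlaqAt`∕`hessPlaq`∕`hess V X Y W := −Σ_{p∈W} Re tr[(dcurl V X Y p + curl V Y p · curl V X p) · V(∂p)]`
   and `hasDerivAt_dAction_vary`: `d/dt|₀ dA(V e^{tX})[Y] = hess V X Y W`, where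
   `dAction V Y W := −Σ_{p∈W} Re tr[(d_V Y)(p) V(∂p)]` is the first variation of `T4AveragingDeficitWall`;
§4 the group law `vary V X (s + t) = vary (vary V X s) X t` and, by translation, the derivatives AT EVERY `s`:
   `hasDerivAt_fineAction_vary_at`: `d/ds A(V e^{sX}) = dAction (V e^{sX}) X`, and
   `hasDerivAt_dAction_vary_at`: `d/ds dAction (V e^{sX}) X = hess (V e^{sX}) X X` — i.e. the hypotheses
   `h1`∕`h2` of `NE3SegmentRSI.response_along_segment` (p207476) and of `NE3EnergyPath.response_along_path` (p206756)
   for the straight segment, with `f′ s = dAction (vary V X s) X W`, `f″ s = hess (vary V X s) X X W`.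
The ordered mixed derivative is not symmetric in (X, Y) away from critical `V`: `hess V X Y − hess V Y X` is the first
variation in the commutator direction (the BCH term of skeleton §1 LOCAL); the diagonal `hess V X X` is what the
restricted-secant inequality integrates.  The B9 (3.10)-shape decomposition of the diagonal (`‖d_V X‖²`-part plus
terms carrying `V(∂p) − 1`) is left to the continuation file `Support/NE3HessBounds` (skeleton leaves L5∕L6).

HONEST FRAMING.  Finite-T⁴ ultraviolet bookkeeping (rung (B)+1 of the cell's ladder); exact identities of matrix
calculus, NO inequality; NOTHING is asserted about Bałaban's minimisers or NE3; no conditional of the cell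
(`BetaPertH`, (B), (B^μ)) is used or hidden; NOT infinite volume, NOT a mass gap, NOT Clay, NOT summit progress.
ABSOLUTE RULE of the cell kept: no printed sentence is a hypothesis of any declaration (context: the second-order
term of [Balaban1985Variational] (26) p. 282 ∕ [Balaban1985BackgroundPropagators] (3.10) p. 391 is what `hess`
computes for the Wilson action written with the tree's `fhol`).  PLACEMENT (human rule 2026-08-19): our lemmas under
`Summits/QuantumFields/BalabanUV/`; imports the accepted `Literature.….T4AveragingDeficitWall` only; moves nothing.
-/

set_option autoImplicit false

open scoped BigOperators Matrix.Norms.L2Operator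
open NormedSpace Finset

namespace Summit.QuantumFields.BalabanUV.T4Continuum.NE3HessForm

open Literature.MathematicalPhysics.QuantumFieldTheory.Balaban1983to89
open B7Prop1Explicit B7Prop2Explicit MatrixLog UnitaryModel
open T4AveragingDeficitWall hiding Site Plane Plaq Bond

noncomputable section

variable {d : ℕ} {n : Type*} [Fintype n] [DecidableEq n]

local notation "𝕄" => Matrix n n ℂ
local notation "Site" => B7Prop1Explicit.Site
local notation "Plaq" => T4AveragingDeficitWall.Plaq

/-! ## §1 The derivative of `t ↦ Ad_{P_t} Y` for the partial holonomies of the plaquette word -/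

/-- One varied factor: `d/dt|₀ Ad_{A e^{tX}} Y = Ad_A (XY − YX)`. [folklore] -/
theorem hasDerivAt_Ad_vary₁ (A : 𝕄ˣ) (X Y : 𝕄) :
    HasDerivAt (fun t : ℝ => Ad (A * expUnit ((t : ℂ) • X)) Y) (Ad A (X * Y - Y * X)) 0 := by
  have h1 : HasDerivAt (fun t : ℝ => (A : 𝕄) * exp ((t : ℂ) • X)) ((A : 𝕄) * X) 0 :=
    (hasDerivAt_exp_smul_zero X).const_mul _
  have h3 : HasDerivAt (fun t : ℝ => exp (-((t : ℂ) • X)) * ((A⁻¹ : 𝕄ˣ) : 𝕄)) (-X * ((A⁻¹ : 𝕄ˣ) : 𝕄)) 0 :=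
    (hasDerivAt_exp_neg_smul_zero X).mul_const _
  have H := (h1.mul_const Y).mul h3
  have H' : HasDerivAt (fun t : ℝ => Ad (A * expUnit ((t : ℂ) • X)) Y)
      ((A : 𝕄) * X * Y * (exp (-(((0 : ℝ) : ℂ) • X)) * ((A⁻¹ : 𝕄ˣ) : 𝕄))
        + (A : 𝕄) * exp (((0 : ℝ) : ℂ) • X) * Y * (-X * ((A⁻¹ : 𝕄ˣ) : 𝕄))) 0 := by
    refine H.congr_of_eventuallyEq (Filter.Eventually.of_forall fun t => ?_)
    simp only [Pi.mul_apply, Ad, Units.val_mul, mul_inv_rev, val_inv_expUnit, val_expUnit, mul_assoc]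
  refine H'.congr_deriv ?_
  simp only [Complex.ofReal_zero, zero_smul, neg_zero, exp_zero, mul_one, one_mul, Ad, mul_sub, sub_mul, neg_mul,
    mul_neg, mul_assoc]
  abel

/-- Two varied factors: `d/dt|₀ Ad_{A e^{tX₁} B e^{tX₂}} Y = Ad_A (X₁·Ad_B Y − Ad_B Y·X₁) + Ad_{AB}(X₂Y − YX₂)`.
[folklore] -/
theorem hasDerivAt_Ad_vary₂ (A B : 𝕄ˣ) (X₁ X₂ Y : 𝕄) :
    HasDerivAt (fun t : ℝ => Ad (A * expUnit ((t : ℂ) • X₁) * (B * expUnit ((t : ℂ) • X₂))) Y)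
      (Ad A (X₁ * Ad B Y - Ad B Y * X₁) + Ad (A * B) (X₂ * Y - Y * X₂)) 0 := by
  have h1 : HasDerivAt (fun t : ℝ => (A : 𝕄) * exp ((t : ℂ) • X₁)) ((A : 𝕄) * X₁) 0 :=
    (hasDerivAt_exp_smul_zero X₁).const_mul _
  have h2 : HasDerivAt (fun t : ℝ => (B : 𝕄) * exp ((t : ℂ) • X₂)) ((B : 𝕄) * X₂) 0 :=
    (hasDerivAt_exp_smul_zero X₂).const_mul _
  have h3 : HasDerivAt (fun t : ℝ => exp (-((t : ℂ) • X₂)) * ((B⁻¹ : 𝕄ˣ) : 𝕄)) (-X₂ * ((B⁻¹ : 𝕄ˣ) : 𝕄)) 0 :=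
    (hasDerivAt_exp_neg_smul_zero X₂).mul_const _
  have h4 : HasDerivAt (fun t : ℝ => exp (-((t : ℂ) • X₁)) * ((A⁻¹ : 𝕄ˣ) : 𝕄)) (-X₁ * ((A⁻¹ : 𝕄ˣ) : 𝕄)) 0 :=
    (hasDerivAt_exp_neg_smul_zero X₁).mul_const _
  have H := ((h1.mul h2).mul_const Y).mul (h3.mul h4)
  have H' : HasDerivAt (fun t : ℝ => Ad (A * expUnit ((t : ℂ) • X₁) * (B * expUnit ((t : ℂ) • X₂))) Y)
      (((A : 𝕄) * X₁ * ((B : 𝕄) * exp (((0 : ℝ) : ℂ) • X₂)) + (A : 𝕄) * exp (((0 : ℝ) : ℂ) • X₁) * ((B : 𝕄) * X₂)) * Y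
          * (exp (-(((0 : ℝ) : ℂ) • X₂)) * ((B⁻¹ : 𝕄ˣ) : 𝕄) * (exp (-(((0 : ℝ) : ℂ) • X₁)) * ((A⁻¹ : 𝕄ˣ) : 𝕄)))
        + (A : 𝕄) * exp (((0 : ℝ) : ℂ) • X₁) * ((B : 𝕄) * exp (((0 : ℝ) : ℂ) • X₂)) * Y
          * (-X₂ * ((B⁻¹ : 𝕄ˣ) : 𝕄) * (exp (-(((0 : ℝ) : ℂ) • X₁)) * ((A⁻¹ : 𝕄ˣ) : 𝕄))
            + exp (-(((0 : ℝ) : ℂ) • X₂)) * ((B⁻¹ : 𝕄ˣ) : 𝕄) * (-X₁ * ((A⁻¹ : 𝕄ˣ) : 𝕄)))) 0 := by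
    refine H.congr_of_eventuallyEq (Filter.Eventually.of_forall fun t => ?_)
    simp only [Pi.mul_apply, Ad, Units.val_mul, mul_inv_rev, val_inv_expUnit, val_expUnit, mul_assoc]
  refine H'.congr_deriv ?_
  simp only [Complex.ofReal_zero, zero_smul, neg_zero, exp_zero, mul_one, one_mul, Ad, Units.val_mul, mul_inv_rev,
    mul_sub, sub_mul, mul_add, add_mul, neg_mul, mul_neg, mul_assoc]
  abel

/-- Three varied factors, the third inverted: `d/dt|₀ Ad_{A e^{tX₁} B e^{tX₂} (C e^{tX₃})⁻¹} Y =
Ad_A (X₁·Ad_{BC⁻¹} Y − Ad_{BC⁻¹} Y·X₁) + Ad_{AB}((X₂ − X₃)·Ad_{C⁻¹} Y − Ad_{C⁻¹} Y·(X₂ − X₃))`. [folklore] -/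
theorem hasDerivAt_Ad_vary₃ (A B C : 𝕄ˣ) (X₁ X₂ X₃ Y : 𝕄) :
    HasDerivAt (fun t : ℝ =>
        Ad (A * expUnit ((t : ℂ) • X₁) * (B * expUnit ((t : ℂ) • X₂)) * (C * expUnit ((t : ℂ) • X₃))⁻¹) Y)
      (Ad A (X₁ * Ad (B * C⁻¹) Y - Ad (B * C⁻¹) Y * X₁)
        + Ad (A * B) ((X₂ - X₃) * Ad C⁻¹ Y - Ad C⁻¹ Y * (X₂ - X₃))) 0 := by
  have h1 : HasDerivAt (fun t : ℝ => (A : 𝕄) * exp ((t : ℂ) • X₁)) ((A : 𝕄) * X₁) 0 :=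
    (hasDerivAt_exp_smul_zero X₁).const_mul _
  have h2 : HasDerivAt (fun t : ℝ => (B : 𝕄) * exp ((t : ℂ) • X₂)) ((B : 𝕄) * X₂) 0 :=
    (hasDerivAt_exp_smul_zero X₂).const_mul _
  have h3 : HasDerivAt (fun t : ℝ => exp (-((t : ℂ) • X₃)) * ((C⁻¹ : 𝕄ˣ) : 𝕄)) (-X₃ * ((C⁻¹ : 𝕄ˣ) : 𝕄)) 0 :=
    (hasDerivAt_exp_neg_smul_zero X₃).mul_const _
  have h3' : HasDerivAt (fun t : ℝ => (C : 𝕄) * exp ((t : ℂ) • X₃)) ((C : 𝕄) * X₃) 0 :=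
    (hasDerivAt_exp_smul_zero X₃).const_mul _
  have h4 : HasDerivAt (fun t : ℝ => exp (-((t : ℂ) • X₂)) * ((B⁻¹ : 𝕄ˣ) : 𝕄)) (-X₂ * ((B⁻¹ : 𝕄ˣ) : 𝕄)) 0 :=
    (hasDerivAt_exp_neg_smul_zero X₂).mul_const _
  have h5 : HasDerivAt (fun t : ℝ => exp (-((t : ℂ) • X₁)) * ((A⁻¹ : 𝕄ˣ) : 𝕄)) (-X₁ * ((A⁻¹ : 𝕄ˣ) : 𝕄)) 0 :=
    (hasDerivAt_exp_neg_smul_zero X₁).mul_const _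
  have H := (((h1.mul h2).mul h3).mul_const Y).mul (h3'.mul (h4.mul h5))
  have H' : HasDerivAt (fun t : ℝ =>
        Ad (A * expUnit ((t : ℂ) • X₁) * (B * expUnit ((t : ℂ) • X₂)) * (C * expUnit ((t : ℂ) • X₃))⁻¹) Y)
      ((((A : 𝕄) * X₁ * ((B : 𝕄) * exp (((0 : ℝ) : ℂ) • X₂)) + (A : 𝕄) * exp (((0 : ℝ) : ℂ) • X₁) * ((B : 𝕄) * X₂))
            * (exp (-(((0 : ℝ) : ℂ) • X₃)) * ((C⁻¹ : 𝕄ˣ) : 𝕄))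
          + (A : 𝕄) * exp (((0 : ℝ) : ℂ) • X₁) * ((B : 𝕄) * exp (((0 : ℝ) : ℂ) • X₂)) * (-X₃ * ((C⁻¹ : 𝕄ˣ) : 𝕄)))
          * Y * ((C : 𝕄) * exp (((0 : ℝ) : ℂ) • X₃)
            * (exp (-(((0 : ℝ) : ℂ) • X₂)) * ((B⁻¹ : 𝕄ˣ) : 𝕄) * (exp (-(((0 : ℝ) : ℂ) • X₁)) * ((A⁻¹ : 𝕄ˣ) : 𝕄))))
        + (A : 𝕄) * exp (((0 : ℝ) : ℂ) • X₁) * ((B : 𝕄) * exp (((0 : ℝ) : ℂ) • X₂))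
            * (exp (-(((0 : ℝ) : ℂ) • X₃)) * ((C⁻¹ : 𝕄ˣ) : 𝕄)) * Y
          * ((C : 𝕄) * X₃ * (exp (-(((0 : ℝ) : ℂ) • X₂)) * ((B⁻¹ : 𝕄ˣ) : 𝕄) * (exp (-(((0 : ℝ) : ℂ) • X₁)) * ((A⁻¹ : 𝕄ˣ) : 𝕄)))
            + (C : 𝕄) * exp (((0 : ℝ) : ℂ) • X₃)
              * (-X₂ * ((B⁻¹ : 𝕄ˣ) : 𝕄) * (exp (-(((0 : ℝ) : ℂ) • X₁)) * ((A⁻¹ : 𝕄ˣ) : 𝕄))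
                + exp (-(((0 : ℝ) : ℂ) • X₂)) * ((B⁻¹ : 𝕄ˣ) : 𝕄) * (-X₁ * ((A⁻¹ : 𝕄ˣ) : 𝕄))))) 0 := by
    refine H.congr_of_eventuallyEq (Filter.Eventually.of_forall fun t => ?_)
    simp only [Pi.mul_apply, Ad, Units.val_mul, mul_inv_rev, inv_inv, val_inv_expUnit, val_expUnit, neg_neg,
      mul_assoc]
  refine H'.congr_deriv ?_
  simp only [Complex.ofReal_zero, zero_smul, neg_zero, exp_zero, mul_one, one_mul, Ad, Units.val_mul, mul_inv_rev,
    inv_inv, mul_sub, sub_mul, mul_add, add_mul, neg_mul, mul_neg, mul_assoc]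
  abel

/-! ## §2 The derivative of the dressed curl along a bondwise variation -/

/-- THE DERIVATIVE OF THE DRESSED CURL: `dcurlAt V X Y z μ ν = d/dt|₀ (d_{V e^{tX}} Y)(z; μ < ν)`, written out term
by term from `curlAt` (bonds `b₁ = (z,μ)`, `b₂ = (z+e_μ, ν)`, `b₃ = (z+e_ν, μ)`, `b₄ = (z, ν)`): every term is a
transported commutator of an `X`-value with a transported `Y`-value. [folklore] -/
def dcurlAt (V : Site d → Fin d → 𝕄ˣ) (X Y : Site d → Fin d → 𝕄) (z : Site d) (μ ν : Fin d) : 𝕄 :=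
  Ad (V z μ) (X z μ * Y z μ - Y z μ * X z μ)
  + (Ad (V z μ) (X z μ * Ad (V (z + e μ) ν) (Y (z + e μ) ν) - Ad (V (z + e μ) ν) (Y (z + e μ) ν) * X z μ)
      + Ad (V z μ * V (z + e μ) ν) (X (z + e μ) ν * Y (z + e μ) ν - Y (z + e μ) ν * X (z + e μ) ν))
  - (Ad (V z μ) (X z μ * Ad (V (z + e μ) ν) (Y (z + e ν) μ) - Ad (V (z + e μ) ν) (Y (z + e ν) μ) * X z μ)
      + Ad (V z μ * V (z + e μ) ν) (X (z + e μ) ν * Y (z + e ν) μ - Y (z + e ν) μ * X (z + e μ) ν))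
  - (Ad (V z μ) (X z μ * Ad (V (z + e μ) ν * (V (z + e ν) μ)⁻¹) (Y z ν)
        - Ad (V (z + e μ) ν * (V (z + e ν) μ)⁻¹) (Y z ν) * X z μ)
      + Ad (V z μ * V (z + e μ) ν) ((X (z + e μ) ν - X (z + e ν) μ) * Ad (V (z + e ν) μ)⁻¹ (Y z ν)
        - Ad (V (z + e ν) μ)⁻¹ (Y z ν) * (X (z + e μ) ν - X (z + e ν) μ)))

/-- **`d/dt|₀ (d_{V e^{tX}} Y)(p′) = dcurlAt V X Y p′`.** [folklore] -/
theorem hasDerivAt_curlAt_vary (V : Site d → Fin d → 𝕄ˣ) (X Y : Site d → Fin d → 𝕄) (z : Site d) (μ ν : Fin d) :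
    HasDerivAt (fun t : ℝ => curlAt (vary V X t) Y z μ ν) (dcurlAt V X Y z μ ν) 0 := by
  have h₁ := hasDerivAt_Ad_vary₁ (V z μ) (X z μ) (Y z μ)
  have h₂ := hasDerivAt_Ad_vary₂ (V z μ) (V (z + e μ) ν) (X z μ) (X (z + e μ) ν) (Y (z + e μ) ν)
  have h₃ := hasDerivAt_Ad_vary₂ (V z μ) (V (z + e μ) ν) (X z μ) (X (z + e μ) ν) (Y (z + e ν) μ)
  have h₄ := hasDerivAt_Ad_vary₃ (V z μ) (V (z + e μ) ν) (V (z + e ν) μ) (X z μ) (X (z + e μ) ν) (X (z + e ν) μ)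
    (Y z ν)
  have H := ((h₁.add h₂).sub h₃).sub h₄
  refine H.congr_of_eventuallyEq (Filter.Eventually.of_forall fun t => ?_)
  simp only [Pi.add_apply, Pi.sub_apply, curlAt, vary]

/-- The same on indexed plaquettes. [folklore] -/
def dcurl (V : Site d → Fin d → 𝕄ˣ) (X Y : Site d → Fin d → 𝕄) (p : Plaq d) : 𝕄 :=
  dcurlAt V X Y p.1 p.2.1.1 p.2.1.2

/-- `d/dt|₀ (d_{V e^{tX}} Y)(p) = dcurl V X Y p`. [folklore] -/
theorem hasDerivAt_curl_vary (V : Site d → Fin d → 𝕄ˣ) (X Y : Site d → Fin d → 𝕄) (p : Plaq d) :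
    HasDerivAt (fun t : ℝ => curl (vary V X t) Y p) (dcurl V X Y p) 0 :=
  hasDerivAt_curlAt_vary V X Y p.1 p.2.1.1 p.2.1.2

/-! ## §3 The mixed Hessian form of the Wilson action -/

/-- THE FIRST-VARIATION DENSITY summed over a window: `dAction V Y W := −Σ_{p∈W} Re tr[(d_V Y)(p)·V(∂p)]`
(= the derivative value of `T4AveragingDeficitWall.hasDerivAt_fineAction_vary`). [folklore] -/
def dAction (V : Site d → Fin d → 𝕄ˣ) (Y : Site d → Fin d → 𝕄) (W : Finset (Plaq d)) : ℝ :=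
  -∑ p ∈ W, nReTr (curl V Y p * ((fhol V p : 𝕄ˣ) : 𝕄))

/-- THE MIXED HESSIAN DENSITY at one plaquette:
`hessPlaqAt V X Y p′ = −Re tr[(dcurlAt V X Y p′ + (d_V Y)(p′)·(d_V X)(p′))·V(∂p′)]`. [folklore] -/
def hessPlaqAt (V : Site d → Fin d → 𝕄ˣ) (X Y : Site d → Fin d → 𝕄) (z : Site d) (μ ν : Fin d) : ℝ :=
  -nReTr ((dcurlAt V X Y z μ ν + curlAt V Y z μ ν * curlAt V X z μ ν)
      * ((hol V z (plaqWord μ ν) : 𝕄ˣ) : 𝕄))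

/-- The mixed Hessian density on indexed plaquettes. [folklore] -/
def hessPlaq (V : Site d → Fin d → 𝕄ˣ) (X Y : Site d → Fin d → 𝕄) (p : Plaq d) : ℝ :=
  hessPlaqAt V X Y p.1 p.2.1.1 p.2.1.2

/-- **THE MIXED HESSIAN FORM** of the Wilson action of the window `W`:
`hess V X Y W := Σ_{p∈W} hessPlaq V X Y p = ∂_s∂_t|₀ A_W((V e^{sX}) e^{tY})` (`hasDerivAt_dAction_vary`). [folklore] -/
def hess (V : Site d → Fin d → 𝕄ˣ) (X Y : Site d → Fin d → 𝕄) (W : Finset (Plaq d)) : ℝ :=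
  ∑ p ∈ W, hessPlaq V X Y p

/-- One plaquette: `d/dt|₀ (−Re tr[(d_{V_t} Y)(p′) V_t(∂p′)]) = hessPlaqAt V X Y p′`, `V_t = V e^{tX}`. [folklore] -/
theorem hasDerivAt_dwtAt_vary (V : Site d → Fin d → 𝕄ˣ) (X Y : Site d → Fin d → 𝕄) (z : Site d) (μ ν : Fin d) :
    HasDerivAt (fun t : ℝ => -nReTr (curlAt (vary V X t) Y z μ ν
        * ((hol (vary V X t) z (plaqWord μ ν) : 𝕄ˣ) : 𝕄))) (hessPlaqAt V X Y z μ ν) 0 := by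
  have h := (hasDerivAt_curlAt_vary V X Y z μ ν).mul (hasDerivAt_hol_vary V X z μ ν)
  have h2 := ((nReTrL (n := n)).hasFDerivAt.comp_hasDerivAt (0 : ℝ) h).neg
  have h3 : HasDerivAt (fun t : ℝ => -nReTr (curlAt (vary V X t) Y z μ ν
        * ((hol (vary V X t) z (plaqWord μ ν) : 𝕄ˣ) : 𝕄)))
      (-nReTr (dcurlAt V X Y z μ ν * ((hol V z (plaqWord μ ν) : 𝕄ˣ) : 𝕄)
        + curlAt V Y z μ ν * (curlAt V X z μ ν * ((hol V z (plaqWord μ ν) : 𝕄ˣ) : 𝕄)))) 0 := by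
    refine (h2.congr_of_eventuallyEq (Filter.Eventually.of_forall fun t => ?_)).congr_deriv ?_
    · simp only [Pi.neg_apply, Function.comp_apply, Pi.mul_apply, nReTrL_apply]
    · simp only [vary_zero, nReTrL_apply]
  refine h3.congr_deriv ?_
  simp only [hessPlaqAt, add_mul, mul_assoc]

/-- Indexed plaquettes: `d/dt|₀ (−Re tr[(d_{V_t} Y)(p) V_t(∂p)]) = hessPlaq V X Y p`. [folklore] -/
theorem hasDerivAt_dwt_vary (V : Site d → Fin d → 𝕄ˣ) (X Y : Site d → Fin d → 𝕄) (p : Plaq d) :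
    HasDerivAt (fun t : ℝ => -nReTr (curl (vary V X t) Y p * ((fhol (vary V X t) p : 𝕄ˣ) : 𝕄)))
      (hessPlaq V X Y p) 0 :=
  hasDerivAt_dwtAt_vary V X Y p.1 p.2.1.1 p.2.1.2

/-- **`d/dt|₀ dAction (V e^{tX}) Y W = hess V X Y W`** — the mixed second derivative `∂_s∂_t|₀ A_W((Ve^{sX})e^{tY})`
(with `T4AveragingDeficitWall.hasDerivAt_fineAction_vary` for the inner derivative). [folklore] -/
theorem hasDerivAt_dAction_vary (V : Site d → Fin d → 𝕄ˣ) (X Y : Site d → Fin d → 𝕄) (W : Finset (Plaq d)) :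
    HasDerivAt (fun t : ℝ => dAction (vary V X t) Y W) (hess V X Y W) 0 := by
  have h := HasDerivAt.sum (u := W) (x := (0 : ℝ))
    (A := fun p t => -nReTr (curl (vary V X t) Y p * ((fhol (vary V X t) p : 𝕄ˣ) : 𝕄)))
    (A' := fun p => hessPlaq V X Y p) fun p _ => hasDerivAt_dwt_vary V X Y p
  have h' : HasDerivAt (fun t : ℝ => ∑ p ∈ W, -nReTr (curl (vary V X t) Y p * ((fhol (vary V X t) p : 𝕄ˣ) : 𝕄)))
      (∑ p ∈ W, hessPlaq V X Y p) 0 := by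
    simpa [Finset.sum_fn] using h
  refine (h'.congr_of_eventuallyEq (Filter.Eventually.of_forall fun t => ?_)).congr_deriv rfl
  simp only [dAction, Finset.sum_neg_distrib]

/-! ## §4 The group law of `vary` and the derivatives at every parameter -/

/-- `V e^{(s+t)X} = (V e^{sX}) e^{tX}` bondwise. [folklore] -/
theorem vary_add (V : Site d → Fin d → 𝕄ˣ) (X : Site d → Fin d → 𝕄) (s t : ℝ) :
    vary V X (s + t) = vary (vary V X s) X t := by
  letI : NormedAlgebra ℚ 𝕄 := NormedAlgebra.restrictScalars ℚ ℂ 𝕄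
  funext x κ
  have hc : Commute ((s : ℂ) • X x κ) ((t : ℂ) • X x κ) := ((Commute.refl (X x κ)).smul_left _).smul_right _
  simp only [vary, mul_assoc]
  congr 1
  apply Units.ext
  simp only [Units.val_mul, val_expUnit, Complex.ofReal_add, add_smul]
  exact exp_add_of_commute hc

/-- **FIRST DERIVATIVE AT EVERY `s`:** `d/ds A_W(V e^{sX}) = dAction (V e^{sX}) X W`. [folklore] -/
theorem hasDerivAt_fineAction_vary_at (V : Site d → Fin d → 𝕄ˣ) (X : Site d → Fin d → 𝕄) (W : Finset (Plaq d))
    (s : ℝ) : HasDerivAt (fun t : ℝ => fineAction (vary V X t) W) (dAction (vary V X s) X W) s := by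
  have h0 : HasDerivAt (fun u : ℝ => fineAction (vary (vary V X s) X u) W) (dAction (vary V X s) X W) 0 := by
    simpa [dAction] using hasDerivAt_fineAction_vary (vary V X s) X W
  have h1 : HasDerivAt (fun t : ℝ => t - s) 1 s := by simpa using (hasDerivAt_id s).sub_const s
  have h2 := h0.comp_of_eq s h1 (by simp)
  refine (h2.congr_of_eventuallyEq (Filter.Eventually.of_forall fun t => ?_)).congr_deriv (by simp)
  simp only [Function.comp_def, ← vary_add, add_sub_cancel]

/-- **SECOND DERIVATIVE AT EVERY `s`:** `d/ds dAction (V e^{sX}) X W = hess (V e^{sX}) X X W`. [folklore] -/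
theorem hasDerivAt_dAction_vary_at (V : Site d → Fin d → 𝕄ˣ) (X : Site d → Fin d → 𝕄) (W : Finset (Plaq d))
    (s : ℝ) : HasDerivAt (fun t : ℝ => dAction (vary V X t) X W) (hess (vary V X s) X X W) s := by
  have h0 : HasDerivAt (fun u : ℝ => dAction (vary (vary V X s) X u) X W) (hess (vary V X s) X X W) 0 :=
    hasDerivAt_dAction_vary (vary V X s) X X W
  have h1 : HasDerivAt (fun t : ℝ => t - s) 1 s := by simpa using (hasDerivAt_id s).sub_const s
  have h2 := h0.comp_of_eq s h1 (by simp)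
  refine (h2.congr_of_eventuallyEq (Filter.Eventually.of_forall fun t => ?_)).congr_deriv (by simp)
  simp only [Function.comp_def, ← vary_add, add_sub_cancel]

/-- **MIXED DERIVATIVE AT EVERY `s`** (the local step's `h′(s) = ∂_s dA(V e^{sX})[Y]`):
`d/ds dAction (V e^{sX}) Y W = hess (V e^{sX}) X Y W`. [folklore] -/
theorem hasDerivAt_dAction_vary_at₂ (V : Site d → Fin d → 𝕄ˣ) (X Y : Site d → Fin d → 𝕄) (W : Finset (Plaq d))
    (s : ℝ) : HasDerivAt (fun t : ℝ => dAction (vary V X t) Y W) (hess (vary V X s) X Y W) s := by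
  have h0 : HasDerivAt (fun u : ℝ => dAction (vary (vary V X s) X u) Y W) (hess (vary V X s) X Y W) 0 :=
    hasDerivAt_dAction_vary (vary V X s) X Y W
  have h1 : HasDerivAt (fun t : ℝ => t - s) 1 s := by simpa using (hasDerivAt_id s).sub_const s
  have h2 := h0.comp_of_eq s h1 (by simp)
  refine (h2.congr_of_eventuallyEq (Filter.Eventually.of_forall fun t => ?_)).congr_deriv (by simp)
  simp only [Function.comp_def, ← vary_add, add_sub_cancel]

/-- **THE STRAIGHT SEGMENT'S DERIVATIVE DATA** in the form consumed by `NE3SegmentRSI.response_along_segment`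
(p207476) and `NE3EnergyPath.response_along_path` (p206756): with `f t = A_W(V e^{tX})`, `f′ t = dAction (V e^{tX}) X W`,
`f″ t = hess (V e^{tX}) X X W`, both `HasDerivAt` hypotheses hold on `[0,1]` (indeed everywhere). [folklore] -/
theorem segment_derivData (V : Site d → Fin d → 𝕄ˣ) (X : Site d → Fin d → 𝕄) (W : Finset (Plaq d)) :
    (∀ t ∈ Set.Icc (0 : ℝ) 1,
        HasDerivAt (fun s : ℝ => fineAction (vary V X s) W) (dAction (vary V X t) X W) t) ∧
      (∀ t ∈ Set.Icc (0 : ℝ) 1,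
        HasDerivAt (fun s : ℝ => dAction (vary V X s) X W) (hess (vary V X t) X X W) t) :=
  ⟨fun t _ => hasDerivAt_fineAction_vary_at V X W t, fun t _ => hasDerivAt_dAction_vary_at V X W t⟩

/-! ## §5 Sanity: at a flat configuration with the zero direction everything vanishes -/

/-- `dcurlAt V 0 Y = 0` (no variation, no derivative). [folklore] -/
theorem dcurlAt_zero_left (V : Site d → Fin d → 𝕄ˣ) (Y : Site d → Fin d → 𝕄) (z : Site d) (μ ν : Fin d) :
    dcurlAt V (fun _ _ => 0) Y z μ ν = 0 := by
  simp [dcurlAt, Ad]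

/-- `hess V 0 Y W = 0`. [folklore] -/
theorem hess_zero_left (V : Site d → Fin d → 𝕄ˣ) (Y : Site d → Fin d → 𝕄) (W : Finset (Plaq d)) :
    hess V (fun _ _ => 0) Y W = 0 := by
  simp [hess, hessPlaq, hessPlaqAt, dcurlAt_zero_left, Ad, T4AveragingDeficitWall.curlAt, nReTr]

end

end Summit.QuantumFields.BalabanUV.T4Continuum.NE3HessForm
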